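import Summits.BirchSwinnertonDyer.BirchSwinnertonDyer.Theorems.PublishedInputsGreenbergKerGCountOfCassels
import Summits.BirchSwinnertonDyer.BirchSwinnertonDyer.Theorems.KatoDescentPotSupersingularWildFineSelmerFineUnitAnchorTamagawa
import Summits.BirchSwinnertonDyer.Rank1Residual.Iwasawa.LocalTowerKernelAtPGoodOrdinary
import HarnessLib

set_option linter.dupNamespace false -- `…BirchSwinnertonDyer.BirchSwinnertonDyer…` is the cell's nested layout (D-0017)
set_option autoImplicit false

/-!
# Greenberg LNM 1716 Thm. 4.1 — an UNCONDITIONAL case over `ℚ`: good ordinary NON-ANOMALOUS `p`,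
# `p ∤ ∏ c_ℓ`, `E(ℚ)[p] = 0`, `Sel_{p^∞}(E/ℚ)` finite ⟹ `f_E(0) ∼ #Sel_{p^∞}(E/ℚ)`

Seat `bsd-inputs-k4-p1` (gen 4; LADDER-BSD D-0154 KEY (147)(f) «prove the printed input», row 1 K4 INPUTS; Greenberg
1999), `--supports stmt-BirchSwinnertonDyer-20309`. THEOREMS ONLY (no definition, no named fact, no `sorry`).

R. Greenberg, *Iwasawa theory for elliptic curves*, LNM 1716 (1999), Thm. 4.1 (p. 85 printed / p. 102 of the held copy):
"`f_E(0) ∼ (∏_{v bad} c_v^{(p)}) (∏_{v∣p} |Ẽ_v(f_v)_p|²) |Sel_E(F)_p| / |E(F)_p|²`". The sibling file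
`PublishedInputsGreenbergKerGCountOfCassels` proved, for `F = ℚ`, good ordinary `p`, `E(ℚ)[p] = 0`, the GLOBAL part:
`f(0) = u · #Sel_{p^∞}(E/ℚ) · ∏_{v ∈ S} #𝒦_{v,0}[p^∞]` (`InputsGreenbergKerG.constantCoeff_charGenerator_eq_ordinary_rat`),
leaving the two LOCAL orders (Lemma 3.3: `#𝒦_{v,0}[p^∞] = c_v^{(p)}`; Lemma 3.4: `#𝒦_{p,0}[p^∞] = #Ẽ(𝔽_p)_p²`). The tree
PROVES both local orders in their VANISHING cases: `p ∤ ∏ c_ℓ ⟹ 𝒦_{v,0}[p^∞] = 0` at `v ∤ p`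
(`WildFineSelmerFineUnitAnchorTamagawa.localTowerKerPrimary_zero_eq_bot_of_not_dvd_tamagawaProduct`, from the Tamagawa bound
`#𝒦_{v,0}[p^∞] ≤ p^{ord_p c_v}`, cell b2b-bsdres) and `p ∤ #Ẽ(𝔽_p) ⟹ 𝒦_{p,0}[p^∞] = 0`
(`Rank1Residual.Iwasawa.GoodOrdinary.localTowerKerPrimary_zero_eq_bot_of_goodOrdinary_nonAnomalous`, Lemma 3.4 at `n = 0`,
vanishing case). Hence:

* `constantCoeff_charGenerator_eq_natCard_selmer_of_nonAnomalous` — **THEOREM 4.1, UNCONDITIONAL, in the regime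
  «good ordinary non-anomalous `p`, `p ∤ ∏ c_ℓ`, `E(ℚ)[p] = 0`, `Sel_{p^∞}(E/ℚ)` finite»**: for `W/ℚ` globally minimal and
  elliptic, `κ` the cyclotomic `ℤ_p`-extension with topological generator `γ`, ANY Pontryagin-dual datum `D` of
  `Sel_{p^∞}(E/ℚ_∞)` and `char X(E/ℚ_∞) = (f)`: `X` is finitely generated `Λ`-torsion and **`f(0) = u · #Sel_{p^∞}(E/ℚ)`,
  `u ∈ ℤ_pˣ`** — Greenberg's `f_E(0) ∼ |Sel_E(ℚ)_p|` (all of `c_v^{(p)}`, `|Ẽ(𝔽_p)_p|`, `|E(ℚ)_p|` being `1`). Every `p` incl.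
  `p = 2` formally (at `p = 2` good ordinary is always anomalous, so the hypothesis is void there).

HONEST FRAMING: a composition of tree theorems (this seat's LOC/COINV/KerG files, the Lemma 4.2/4.3 assembly, Mazur control
over `ℚ`, Poitou–Tate/Cassels, Coates–Greenberg, the Tamagawa bound, the non-anomalous local vanishing); the named fact
`greenberg_charValue_rankZero` (which carries `#E(ℚ)_p²`, `p^{ord ∏c}`, `#Ẽ(𝔽_p)_p²` for ALL good ordinary odd `p`) is NOT
discharged — only its regime «all three factors trivial» is; no item is closed; no summit statement is proved; BSD is not
proved by any of this.

References: [GreenbergLNM1716] Thm. 4.1 (p. 85), §3 Lemmas 3.3–3.4 (pp. 86–89), §4 Lemmas 4.2–4.7 (pp. 102–108);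
[CoatesSchneiderSujatha2003] p. 203 (Case 1).
-/

noncomputable section

open scoped Classical NumberField

open NumberField IsDedekindDomain Field

namespace Summit.BirchSwinnertonDyer.BirchSwinnertonDyer.Theorems.InputsGreenbergKerG

open Literature.NumberTheory.EllipticCurves Literature.NumberTheory.GaloisRepresentations
  WeierstrassCurve ZpExtension Literature.NumberTheory.EllipticCurves.IwasawaAlgebra
  Literature.NumberTheory.EllipticCurves.Rank1Residual

/-- **Greenberg LNM 1716 Thm. 4.1 over `ℚ`, UNCONDITIONAL in the regime «good ordinary non-anomalous `p`, `p ∤ ∏ c_ℓ`,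
`E(ℚ)[p] = 0`, `Sel_{p^∞}(E/ℚ)` finite»: `f(0) = u · #Sel_{p^∞}(E/ℚ)`.** For `W/ℚ` globally minimal and elliptic with good
ordinary reduction at `p` (`GoodOrd W p`), `p ∤ #Ẽ(𝔽_p)` (`reductionPointCount`), `p ∤ ∏_ℓ c_ℓ` (`tamagawaProduct`),
`E(ℚ)[p] = 0`, `Sel_{p^∞}(E/ℚ)` finite, `κ` the cyclotomic `ℤ_p`-extension with topological generator `γ`, and any
Pontryagin-dual datum `D` with `char(X) = (f)`: `X(E/ℚ_∞)` is finitely generated `Λ`-torsion and `f(0) = u · #Sel_{p^∞}(E/ℚ)`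
for some `u ∈ ℤ_pˣ`. (`constantCoeff_charGenerator_eq_ordinary_rat` with every local order `#𝒦_{v,0}[p^∞] = 1`.)
[cite: GreenbergLNM1716, Thm. 4.1 (p. 85); §3 Lemmas 3.3–3.4 (pp. 86–89)] [cite: CoatesSchneiderSujatha2003, p. 203] -/
theorem constantCoeff_charGenerator_eq_natCard_selmer_of_nonAnomalous {p : ℕ} [hp : Fact p.Prime]
    (W : WeierstrassCurve ℚ) [W.IsGloballyMinimal] [W.IsElliptic] (hgo : GoodOrd W p)
    (hna : ¬ p ∣ W.reductionPointCount p) (htam : ¬ p ∣ W.tamagawaProduct)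
    (κ : ZpExtension ℚ p) (hκ : κ.IsCyclotomic) {γ : absoluteGaloisGroup ℚ} (hγ : κ.IsTopGenerator γ)
    (D : W.SelmerDualData κ γ) [Finite (W.selmerGroupPInfty p)] (hK : ∀ P : W.toAffine.Point, p • P = 0 → P = 0)
    (f : IwasawaAlgebra p) (hf : Module.charIdeal (IwasawaAlgebra p) D.X = Ideal.span {f}) :
    Module.Finite (IwasawaAlgebra p) D.X ∧ Module.IsTorsion (IwasawaAlgebra p) D.X ∧
      ∃ u : ℤ_[p]ˣ, PowerSeries.constantCoeff f = u * Nat.card (W.selmerGroupPInfty p) := by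
  have hord : W.HasGoodReductionAtPrime p ∧ ¬ ((p : ℕ) : ℤ) ∣ W.frobeniusTrace p := hgo
  have hΔ : ¬ ((p : ℕ) : ℤ) ∣ minimalDiscriminantInt W :=
    W.not_dvd_minimalDiscriminantInt_of_hasGoodReductionAtPrime' p hord.1
  -- a finite set `S` containing the bad places and the places above `p`
  obtain ⟨S₀, hgood, -⟩ := SignedEC.ResTwo.exists_finset_mem_unramifiedOutside W p κ.kerSubgroup
    (0 : W.subgroupH1 p κ.kerSubgroup)
  have hpI : (Ideal.span {((p : ℕ) : 𝓞 ℚ)} : Ideal (𝓞 ℚ)) ≠ 0 := by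
    rw [Ne, Ideal.zero_eq_bot, Ideal.span_singleton_eq_bot]
    exact_mod_cast hp.out.ne_zero
  have hSp : {v : HeightOneSpectrum (𝓞 ℚ) | v.asIdeal ∣ Ideal.span {((p : ℕ) : 𝓞 ℚ)}}.Finite := Ideal.finite_factors hpI
  let S : Finset (HeightOneSpectrum (𝓞 ℚ)) := S₀ ∪ hSp.toFinset
  have hS : ∀ v ∉ S, ((p : ℕ) : 𝓞 ℚ) ∉ v.asIdeal ∧ W.HasGoodReductionAt v := by
    intro v hv
    rw [Finset.mem_union, not_or] at hv
    have hpv : ((p : ℕ) : 𝓞 ℚ) ∉ v.asIdeal := fun h ↦ hv.2 (hSp.mem_toFinset.mpr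
      ((Ideal.dvd_span_singleton).mpr h))
    exact ⟨hpv, hgood v hv.1 hpv⟩
  -- every local order is `1`
  have hloc : ∀ v ∈ S, Nat.card (W.localTowerKerPrimary κ (v.adicCompletion ℚ) 0) = 1 := by
    intro v _
    by_cases hpv : ((p : ℕ) : 𝓞 ℚ) ∈ v.asIdeal
    · rw [Summit.BirchSwinnertonDyer.Rank1Residual.Iwasawa.GoodOrdinary.localTowerKerPrimary_zero_eq_bot_of_goodOrdinary_nonAnomalous
        W p hpv hΔ hord.2 hna κ hκ]
      exact Nat.card_unique
    · rw [WildFineSelmerFineUnitAnchorTamagawa.localTowerKerPrimary_zero_eq_bot_of_not_dvd_tamagawaProduct W κ hpv htam]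
      exact Nat.card_unique
  obtain ⟨hFG, hX, u, hu⟩ := constantCoeff_charGenerator_eq_ordinary_rat p W hgo κ hκ hγ D hK S hS f hf
  refine ⟨hFG, hX, u, ?_⟩
  rw [hu, Finset.prod_eq_one (fun v hv ↦ hloc v hv), Nat.cast_one, mul_one]

end Summit.BirchSwinnertonDyer.BirchSwinnertonDyer.Theorems.InputsGreenbergKerG

end
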